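import Mathlib
import Literature.NumberTheory.Sieve.FordMaynardPrimeSumsTuples
import HarnessLib
import HarnessLib.Audit

/-!
# SoloInformed — bands over a base: integrability from and to the fibre primitives

Solo programme `solo-KontsevichZagierPeriods-informed`, session s48 (PROGRAMME L, file 1).

Generic measure theory for the SCALE BAND (file `SoloInformedScaleStep`), the first use of
Kontsevich–Zagier's rule (3) (Newton–Leibniz along a fibre) in the multiple-zeta sector of the
programme.  A BAND over a base `τ ⊆ ℝⁿ` is `B = {(x,t) | x ∈ τ, a x ≤ t ≤ b x} ⊆ ℝⁿ⁺¹` (last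
coordinate `t`), and `F` is a fibrewise primitive of `g` on it (continuous on the closed fibres,
`∂ₜ F = g` on the open fibres).  Two transfers of absolute integrability, both by Fubini/Tonelli
through `MeasurableEquiv.piFinSuccAbove` and the fundamental theorem of calculus on each fibre:

* `soloInformed_integrableOn_band`: if `g ≥ 0` on the open fibres and the fibre integrals
  `F(x, b x) − F(x, a x)` are integrable on `τ`, then `g` is integrable on the band (Tonelli);
* `soloInformed_integrableOn_base`: if `g` is integrable on the band then `x ↦ F(x,b x) − F(x,a x)`
  is integrable on `τ` (Fubini).

Also: the derivative of a monotone function at an interior point is `≥ 0`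
(`soloInformed_deriv_nonneg_of_monotoneOn`).

References: Kontsevich–Zagier 2001 §1.2 rule (3) [KontsevichZagier2001]; the fibre idiom is that
of `Literature.NumberTheory.Transcendental.KZ.eval_eq_zero_of_mem_newtonLeibnizRel_holds`; the
splitting `(MeasurableEquiv.piFinSuccAbove _ (Fin.last n)).symm (t, x) = Fin.snoc x t` is reused from
`Literature.NumberTheory.Sieve.FordMaynard.piFinSuccAbove_last_symm_apply`.
-/

noncomputable section

open MeasureTheory Set Filter Topology

namespace Summit.KontsevichZagierPeriods.KontsevichZagierPeriods.Theorems

/-! ## 1. Monotone functions have non-negative derivatives at interior points -/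

/-- If `m` is monotone on `[u, v]` and differentiable at an interior point `x` with derivative
`m'`, then `0 ≤ m'` (limit of non-negative right slopes). [folklore] -/
theorem soloInformed_deriv_nonneg_of_monotoneOn {m : ℝ → ℝ} {u v x m' : ℝ}
    (hm : MonotoneOn m (Icc u v)) (hux : u < x) (hxv : x < v) (hd : HasDerivAt m m' x) :
    0 ≤ m' := by
  rw [hasDerivAt_iff_tendsto_slope] at hd
  have h2 : Tendsto (slope m x) (𝓝[>] x) (𝓝 m') :=
    hd.mono_left (nhdsWithin_mono _ fun y hy => ne_of_gt hy)
  refine ge_of_tendsto h2 ?_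
  filter_upwards [Ioo_mem_nhdsGT hxv] with y hy
  rw [slope_def_field]
  exact div_nonneg (sub_nonneg.2 (hm ⟨hux.le, hxv.le⟩ ⟨(hux.trans hy.1).le, hy.2.le⟩ hy.1.le))
    (sub_pos.2 hy.1).le

/-! ## 2. Splitting off the last coordinate -/

/-- Membership in a band, fibrewise. -/
theorem soloInformed_snoc_mem_band {n : ℕ} {τ : Set (Fin n → ℝ)} {a b : (Fin n → ℝ) → ℝ}
    (x : Fin n → ℝ) (t : ℝ) :
    (Fin.snoc x t : Fin (n + 1) → ℝ) ∈ {z : Fin (n + 1) → ℝ | (Fin.init z : Fin n → ℝ) ∈ τ ∧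
        a (Fin.init z) ≤ z (Fin.last n) ∧ z (Fin.last n) ≤ b (Fin.init z)} ↔
      x ∈ τ ∧ t ∈ Icc (a x) (b x) := by
  simp only [mem_setOf_eq, Fin.init_snoc, Fin.snoc_last, mem_Icc]

section band

variable {n : ℕ} {τ : Set (Fin n → ℝ)} {B : Set (Fin (n + 1) → ℝ)} {a b : (Fin n → ℝ) → ℝ}
  {F g : (Fin (n + 1) → ℝ) → ℝ}

/-- The fibres of the zero extension of a band function: the indicator of the closed fibre over
points of the base. -/
theorem soloInformed_band_fibre_in
    (hB : B = {z | (Fin.init z : Fin n → ℝ) ∈ τ ∧ a (Fin.init z) ≤ z (Fin.last n) ∧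
      z (Fin.last n) ≤ b (Fin.init z)})
    {x : Fin n → ℝ} (hx : x ∈ τ) (t : ℝ) :
    B.indicator g (Fin.snoc x t) = (Icc (a x) (b x)).indicator (fun t => g (Fin.snoc x t)) t := by
  have hmem : (Fin.snoc x t : Fin (n + 1) → ℝ) ∈ B ↔ x ∈ τ ∧ t ∈ Icc (a x) (b x) := by
    rw [hB]; exact soloInformed_snoc_mem_band x t
  by_cases ht : t ∈ Icc (a x) (b x)
  · rw [indicator_of_mem ht, indicator_of_mem (hmem.2 ⟨hx, ht⟩)]
  · rw [indicator_of_notMem ht, indicator_of_notMem fun h => ht (hmem.1 h).2]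

/-- The fibres of the zero extension of a band function vanish off the base. -/
theorem soloInformed_band_fibre_out
    (hB : B = {z | (Fin.init z : Fin n → ℝ) ∈ τ ∧ a (Fin.init z) ≤ z (Fin.last n) ∧
      z (Fin.last n) ≤ b (Fin.init z)})
    {x : Fin n → ℝ} (hx : x ∉ τ) (t : ℝ) :
    B.indicator g (Fin.snoc x t) = 0 := by
  have hmem : (Fin.snoc x t : Fin (n + 1) → ℝ) ∈ B ↔ x ∈ τ ∧ t ∈ Icc (a x) (b x) := by
    rw [hB]; exact soloInformed_snoc_mem_band x t
  rw [indicator_of_notMem fun h => hx (hmem.1 h).1]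

/-- On a fibre over the base, the primitive computes the fibre integral of a non-negative
derivative: `∫ ‖1_B g (x,·)‖ = F(x, b x) − F(x, a x)`. -/
theorem soloInformed_band_fibre_integral_norm
    (hB : B = {z | (Fin.init z : Fin n → ℝ) ∈ τ ∧ a (Fin.init z) ≤ z (Fin.last n) ∧
      z (Fin.last n) ≤ b (Fin.init z)})
    (hab : ∀ x ∈ τ, a x ≤ b x)
    (hcont : ∀ x ∈ τ, ContinuousOn (fun t => F (Fin.snoc x t)) (Icc (a x) (b x)))
    (hderiv : ∀ x ∈ τ, ∀ t ∈ Ioo (a x) (b x),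
      HasDerivAt (fun s => F (Fin.snoc x s)) (g (Fin.snoc x t)) t)
    (hpos : ∀ x ∈ τ, ∀ t ∈ Ioo (a x) (b x), 0 ≤ g (Fin.snoc x t))
    {x : Fin n → ℝ} (hx : x ∈ τ) :
    ∫ t, ‖B.indicator g (Fin.snoc x t)‖ = F (Fin.snoc x (b x)) - F (Fin.snoc x (a x)) := by
  have hD := intervalIntegral.integrableOn_deriv_of_nonneg (hcont x hx) (hderiv x hx) (hpos x hx)
  have hint : IntervalIntegrable (fun t => g (Fin.snoc x t)) volume (a x) (b x) :=
    (intervalIntegrable_iff_integrableOn_Ioc_of_le (hab x hx)).2 hD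
  have h1 : (fun t : ℝ => ‖B.indicator g (Fin.snoc x t)‖) =
      (Icc (a x) (b x)).indicator fun t => ‖g (Fin.snoc x t)‖ := by
    ext t
    rw [soloInformed_band_fibre_in (g := g) hB hx t, norm_indicator_eq_indicator_norm]
  calc ∫ t, ‖B.indicator g (Fin.snoc x t)‖
      = ∫ t in Icc (a x) (b x), ‖g (Fin.snoc x t)‖ := by
        rw [h1, integral_indicator measurableSet_Icc]
    _ = ∫ t in Ioo (a x) (b x), ‖g (Fin.snoc x t)‖ := by
        rw [integral_Icc_eq_integral_Ioc, integral_Ioc_eq_integral_Ioo]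
    _ = ∫ t in Ioo (a x) (b x), g (Fin.snoc x t) :=
        setIntegral_congr_fun measurableSet_Ioo fun t ht => Real.norm_of_nonneg (hpos x hx t ht)
    _ = ∫ t in (a x)..(b x), g (Fin.snoc x t) := by
        rw [← integral_Ioc_eq_integral_Ioo, intervalIntegral.integral_of_le (hab x hx)]
    _ = F (Fin.snoc x (b x)) - F (Fin.snoc x (a x)) :=
        intervalIntegral.integral_eq_sub_of_hasDerivAt_of_le (hab x hx) (hcont x hx) (hderiv x hx)
          hint

/-- **Tonelli for a band: integrability of a non-negative fibre derivative from the integrability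
of the fibre integrals.**  If `F` is a fibrewise primitive of `g ≥ 0` on the band `B` over `τ` and
`x ↦ F(x, b x) − F(x, a x)` is integrable on `τ`, then `g` is integrable on `B`. [folklore] -/
theorem soloInformed_integrableOn_band (hτ : MeasurableSet τ) (hBm : MeasurableSet B)
    (hB : B = {z | (Fin.init z : Fin n → ℝ) ∈ τ ∧ a (Fin.init z) ≤ z (Fin.last n) ∧
      z (Fin.last n) ≤ b (Fin.init z)})
    (hab : ∀ x ∈ τ, a x ≤ b x)
    (hcont : ∀ x ∈ τ, ContinuousOn (fun t => F (Fin.snoc x t)) (Icc (a x) (b x)))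
    (hderiv : ∀ x ∈ τ, ∀ t ∈ Ioo (a x) (b x),
      HasDerivAt (fun s => F (Fin.snoc x s)) (g (Fin.snoc x t)) t)
    (hpos : ∀ x ∈ τ, ∀ t ∈ Ioo (a x) (b x), 0 ≤ g (Fin.snoc x t))
    (hgm : AEStronglyMeasurable g (volume.restrict B))
    (hI : IntegrableOn (fun x => F (Fin.snoc x (b x)) - F (Fin.snoc x (a x))) τ) :
    IntegrableOn g B := by
  rw [← integrable_indicator_iff hBm]
  have hGm : AEStronglyMeasurable (B.indicator g) volume :=
    (aestronglyMeasurable_indicator_iff hBm).2 hgm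
  set e : (Fin (n + 1) → ℝ) ≃ᵐ ℝ × (Fin n → ℝ) :=
    MeasurableEquiv.piFinSuccAbove (fun _ => ℝ) (Fin.last n) with he_def
  have he : MeasurePreserving e volume volume :=
    volume_preserving_piFinSuccAbove (fun _ => ℝ) (Fin.last n)
  have he_symm : ∀ p : ℝ × (Fin n → ℝ), e.symm p = Fin.snoc p.2 p.1 :=
    Literature.NumberTheory.Sieve.FordMaynard.piFinSuccAbove_last_symm_apply n
  -- the integrand transported to the product
  have hfm : AEStronglyMeasurable (fun p : ℝ × (Fin n → ℝ) => B.indicator g (Fin.snoc p.2 p.1))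
      ((volume : Measure ℝ).prod (volume : Measure (Fin n → ℝ))) := by
    have h := hGm.comp_quasiMeasurePreserving (he.symm e).quasiMeasurePreserving
    rw [← Measure.volume_eq_prod]
    convert h using 1
    ext p
    simp [he_symm]
  suffices hprod : Integrable (fun p : ℝ × (Fin n → ℝ) => B.indicator g (Fin.snoc p.2 p.1))
      ((volume : Measure ℝ).prod (volume : Measure (Fin n → ℝ))) by
    have hcomp : (B.indicator g ∘ e.symm) = fun p : ℝ × (Fin n → ℝ) =>
        B.indicator g (Fin.snoc p.2 p.1) := by
      funext p
      rw [Function.comp_apply, he_symm]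
    have h2 : Integrable (B.indicator g ∘ e.symm) (volume : Measure (ℝ × (Fin n → ℝ))) := by
      rw [hcomp, Measure.volume_eq_prod]
      exact hprod
    exact ((he.symm e).integrable_comp_emb e.symm.measurableEmbedding).mp h2
  rw [integrable_prod_iff' hfm]
  constructor
  · -- a.e. fibre is integrable
    refine Eventually.of_forall fun x => ?_
    by_cases hx : x ∈ τ
    · have h : (fun t : ℝ => B.indicator g (Fin.snoc x t)) =
          (Icc (a x) (b x)).indicator fun t => g (Fin.snoc x t) :=
        funext (soloInformed_band_fibre_in (g := g) hB hx)
      simp only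
      rw [h, integrable_indicator_iff measurableSet_Icc, integrableOn_Icc_iff_integrableOn_Ioc]
      exact intervalIntegral.integrableOn_deriv_of_nonneg (hcont x hx) (hderiv x hx) (hpos x hx)
    · have h : (fun t : ℝ => B.indicator g (Fin.snoc x t)) = fun _ => 0 :=
        funext (soloInformed_band_fibre_out (g := g) hB hx)
      simp only
      rw [h]
      exact integrable_zero _ _ _
  · -- the fibre integrals are the given integrable function on the base
    have hfun : (fun x : Fin n → ℝ => ∫ t, ‖B.indicator g (Fin.snoc x t)‖) =
        τ.indicator fun x => F (Fin.snoc x (b x)) - F (Fin.snoc x (a x)) := by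
      ext x
      by_cases hx : x ∈ τ
      · rw [indicator_of_mem hx]
        exact soloInformed_band_fibre_integral_norm hB hab hcont hderiv hpos hx
      · rw [indicator_of_notMem hx]
        simp [soloInformed_band_fibre_out (g := g) hB hx]
    rw [hfun]
    exact (integrable_indicator_iff hτ).2 hI

/-- **Fubini for a band: integrability of the fibre integrals from integrability on the band.**
If `F` is a fibrewise primitive of `g` on the band `B` over `τ`, `g` is integrable on `B`, and
`f x = F(x, b x) − F(x, a x)` on `τ`, then `f` is integrable on `τ`. [folklore] -/
theorem soloInformed_integrableOn_base {f : (Fin n → ℝ) → ℝ} (hτ : MeasurableSet τ)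
    (hBm : MeasurableSet B)
    (hB : B = {z | (Fin.init z : Fin n → ℝ) ∈ τ ∧ a (Fin.init z) ≤ z (Fin.last n) ∧
      z (Fin.last n) ≤ b (Fin.init z)})
    (hab : ∀ x ∈ τ, a x ≤ b x)
    (hcont : ∀ x ∈ τ, ContinuousOn (fun t => F (Fin.snoc x t)) (Icc (a x) (b x)))
    (hderiv : ∀ x ∈ τ, ∀ t ∈ Ioo (a x) (b x),
      HasDerivAt (fun s => F (Fin.snoc x s)) (g (Fin.snoc x t)) t)
    (hG : IntegrableOn g B)
    (hf : ∀ x ∈ τ, f x = F (Fin.snoc x (b x)) - F (Fin.snoc x (a x))) :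
    IntegrableOn f τ := by
  have hGi : Integrable (B.indicator g) := (integrable_indicator_iff hBm).2 hG
  set e : (Fin (n + 1) → ℝ) ≃ᵐ ℝ × (Fin n → ℝ) :=
    MeasurableEquiv.piFinSuccAbove (fun _ => ℝ) (Fin.last n) with he_def
  have he : MeasurePreserving e volume volume :=
    volume_preserving_piFinSuccAbove (fun _ => ℝ) (Fin.last n)
  have he_symm : ∀ p : ℝ × (Fin n → ℝ), e.symm p = Fin.snoc p.2 p.1 :=
    Literature.NumberTheory.Sieve.FordMaynard.piFinSuccAbove_last_symm_apply n
  have hG2 : Integrable (fun p : ℝ × (Fin n → ℝ) => B.indicator g (Fin.snoc p.2 p.1))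
      ((volume : Measure ℝ).prod (volume : Measure (Fin n → ℝ))) := by
    have h := ((he.symm e).integrable_comp_emb e.symm.measurableEmbedding
      (g := B.indicator g)).mpr hGi
    rw [← Measure.volume_eq_prod]
    convert h using 1
    ext p
    simp [he_symm]
  have h3 : Integrable (fun x : Fin n → ℝ => ∫ t, B.indicator g (Fin.snoc x t)) volume :=
    hG2.integral_prod_right
  have hae : (fun x : Fin n → ℝ => ∫ t, B.indicator g (Fin.snoc x t)) =ᵐ[volume]
      τ.indicator fun x => F (Fin.snoc x (b x)) - F (Fin.snoc x (a x)) := by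
    filter_upwards [hG2.prod_left_ae] with x hx
    by_cases hxτ : x ∈ τ
    · have h : (fun t : ℝ => B.indicator g (Fin.snoc x t)) =
          (Icc (a x) (b x)).indicator fun t => g (Fin.snoc x t) :=
        funext (soloInformed_band_fibre_in (g := g) hB hxτ)
      rw [indicator_of_mem hxτ, h, integral_indicator measurableSet_Icc,
        integral_Icc_eq_integral_Ioc, ← intervalIntegral.integral_of_le (hab x hxτ)]
      apply intervalIntegral.integral_eq_sub_of_hasDerivAt_of_le (hab x hxτ) (hcont x hxτ)
        (hderiv x hxτ)
      rw [intervalIntegrable_iff_integrableOn_Icc_of_le (hab x hxτ)]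
      have hx' : Integrable (fun t => B.indicator g (Fin.snoc x t)) := hx
      rw [h] at hx'
      exact (integrable_indicator_iff measurableSet_Icc).mp hx'
    · have h : (fun t : ℝ => B.indicator g (Fin.snoc x t)) = fun _ => 0 :=
        funext (soloInformed_band_fibre_out (g := g) hB hxτ)
      rw [indicator_of_notMem hxτ, h, integral_zero]
  have h4 : IntegrableOn (fun x => F (Fin.snoc x (b x)) - F (Fin.snoc x (a x))) τ :=
    (integrable_indicator_iff hτ).1 (h3.congr hae)
  exact h4.congr_fun (fun x hx => (hf x hx).symm) hτ

end band

end Summit.KontsevichZagierPeriods.KontsevichZagierPeriods.Theorems
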